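import Summits.QuantumFields.YangMills.Theorems.ColdStartUniversalityLatticeLangevinDossSussmannSmoothingPrep
import HarnessLib

/-!
# Route `ColdStartUniversality` (fixed-cut-off SZZ dynamics; Doss–Sussmann smoothing programme, file 8):
# DIFFERENTIATING UNDER THE EXPECTATION — VECTOR-VALUED PREPARATIONS AND THE ABSTRACT `C¹` STEP

Helper file (seat `ym-line-csu-p1`, g24).  Generic measure-theoretic calculus used to iterate the smoothing theorem to
second order (`P_t(C²) ⊂ C²`):
* `aestronglyMeasurable_clm_of_apply'` — vector-valued version of file 4: `ω ↦ (L_ω : H →L E')` on a finite-dimensional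
  `H` is a.e.-strongly measurable as soon as all evaluations are;
* `aestronglyMeasurable_fderiv_param'` — `ω`-measurability of an `E'`-valued Fréchet derivative from difference quotients,
  needing measurability of `F(M, ·)` only for `M` NEAR the base point;
* ★ `hasFDerivAt_integral_step` — the abstract step: if `F(·, ω)` is differentiable on an open `U₀` with derivative
  `F'(·, ω)` continuous on `U₀` and LOCALLY UNIFORMLY (in `ω`) bounded, `F(M, ·)` measurable and integrable for `M ∈ U₀`,
  then for every `M₀ ∈ U₀`: `D(∫F)(M₀) = ∫F'(M₀)`, `M ↦ ∫F'(M)` is continuous at `M₀`, and `F'(M₀, ·)` is measurable and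
  integrable — so the step can be ITERATED; `contDiffOn_one_integral` packages the `C¹` conclusion.
THEOREMS ONLY, no sorry.  HONEST FRAMING: plumbing; nothing K-uniform; no crux, rung or summit statement is proved; the
Yang–Mills mass gap is NOT proved.
-/

set_option autoImplicit false

noncomputable section

namespace Summit.QuantumFields.YangMills.Theorems.ColdStartUniversality

open MeasureTheory Finset Filter Set Metric Function
open scoped NNReal Topology

/-! ## Vector-valued measurability lemmas -/

/-- **Dual-basis expansion, vector-valued**: `L = Σ_i (b^*_i).smulRight (L b_i)`. [folklore] -/
theorem clm_eq_sum_coord_smulRight {H : Type*} [NormedAddCommGroup H] [NormedSpace ℝ H] [FiniteDimensional ℝ H]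
    {E' : Type*} [NormedAddCommGroup E'] [NormedSpace ℝ E']
    {ι : Type*} [Fintype ι] (b : Module.Basis ι ℝ H) (L : H →L[ℝ] E') :
    L = ∑ i, (LinearMap.toContinuousLinearMap (b.coord i)).smulRight (L (b i)) := by
  classical
  apply ContinuousLinearMap.coe_injective
  refine b.ext fun j => ?_
  simp only [ContinuousLinearMap.coe_coe, _root_.sum_apply, ContinuousLinearMap.smulRight_apply,
    LinearMap.coe_toContinuousLinearMap', Module.Basis.coord_apply, Module.Basis.repr_self]
  rw [Finset.sum_eq_single j]
  · simp
  · intro i _ hij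
    rw [Finsupp.single_apply, if_neg (Ne.symm hij), zero_smul]
  · intro h; exact absurd (Finset.mem_univ j) h

/-- ★ **An operator-valued map is a.e.-strongly measurable if all its evaluations are** (finite-dimensional domain, any
normed codomain). [folklore] -/
theorem aestronglyMeasurable_clm_of_apply' {Ω : Type*} [MeasurableSpace Ω] {μ : Measure Ω}
    {H : Type*} [NormedAddCommGroup H] [NormedSpace ℝ H] [FiniteDimensional ℝ H]
    {E' : Type*} [NormedAddCommGroup E'] [NormedSpace ℝ E']
    (φ : Ω → H →L[ℝ] E') (h : ∀ v : H, AEStronglyMeasurable (fun ω => φ ω v) μ) :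
    AEStronglyMeasurable φ μ := by
  let b := Module.finBasis ℝ H
  have heq : φ = fun ω => ∑ i, (LinearMap.toContinuousLinearMap (b.coord i)).smulRight (φ ω (b i)) := by
    funext ω; exact clm_eq_sum_coord_smulRight b (φ ω)
  have hterm : ∀ i : Fin (Module.finrank ℝ H), AEStronglyMeasurable
      (fun ω => (LinearMap.toContinuousLinearMap (b.coord i)).smulRight (φ ω (b i))) μ := fun i =>
    (ContinuousLinearMap.smulRightL ℝ H E' (LinearMap.toContinuousLinearMap (b.coord i))).continuous
      |>.comp_aestronglyMeasurable (h (b i))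
  have hsum : AEStronglyMeasurable (fun ω => ∑ i : Fin (Module.finrank ℝ H),
      (LinearMap.toContinuousLinearMap (b.coord i)).smulRight (φ ω (b i))) μ :=
    Finset.aestronglyMeasurable_fun_sum (Finset.univ : Finset (Fin (Module.finrank ℝ H))) fun i _ => hterm i
  rw [heq]; exact hsum

/-- ★ **Measurability of an `E'`-valued derivative in a parameter, local version.**  If `F(·, ω)` has derivative `F'(ω)`
at `M₀` for every `ω` and `ω ↦ F(M, ω)` is a.e.-strongly measurable for all `M` in a neighbourhood of `M₀`, then
`ω ↦ F'(ω)` is a.e.-strongly measurable. [folklore] -/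
theorem aestronglyMeasurable_fderiv_param' {Ω : Type*} [MeasurableSpace Ω] {μ : Measure Ω}
    {H : Type*} [NormedAddCommGroup H] [NormedSpace ℝ H] [FiniteDimensional ℝ H]
    {E' : Type*} [NormedAddCommGroup E'] [NormedSpace ℝ E']
    {F : H → Ω → E'} {F' : Ω → H →L[ℝ] E'} {M₀ : H} {U : Set H} (hU : U ∈ 𝓝 M₀)
    (hF : ∀ M ∈ U, AEStronglyMeasurable (F M) μ) (hd : ∀ ω, HasFDerivAt (fun M => F M ω) (F' ω) M₀) :
    AEStronglyMeasurable F' μ := by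
  refine aestronglyMeasurable_clm_of_apply' F' fun v => ?_
  obtain ⟨ε, hε, hball⟩ := Metric.mem_nhds_iff.1 hU
  -- choose `N` with `‖v‖ / (N + 1) < ε`
  obtain ⟨N, hN⟩ := exists_nat_gt (‖v‖ / ε)
  have hmem : ∀ n : ℕ, M₀ + ((n : ℝ) + N + 1)⁻¹ • v ∈ U := by
    intro n
    apply hball
    rw [mem_ball, dist_eq_norm, add_sub_cancel_left, norm_smul, norm_inv, Real.norm_eq_abs,
      abs_of_pos (by positivity)]
    have hpos : (0 : ℝ) < (n : ℝ) + N + 1 := by positivity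
    rw [inv_mul_lt_iff₀ hpos]
    have h1 : ‖v‖ < ε * ((N : ℝ) + 1) := by
      have := (div_lt_iff₀ hε).1 hN
      nlinarith
    nlinarith [hε.le, (Nat.cast_nonneg n : (0:ℝ) ≤ n)]
  have hlim : ∀ ω, Tendsto (fun n : ℕ => ((n : ℝ) + N + 1) • (F (M₀ + ((n : ℝ) + N + 1)⁻¹ • v) ω - F M₀ ω)) atTop
      (𝓝 (F' ω v)) := by
    intro ω
    have hc : Tendsto (fun n : ℕ => ‖(n : ℝ) + N + 1‖) atTop atTop := by
      have h1 : Tendsto (fun n : ℕ => (n : ℝ) + N + 1) atTop atTop :=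
        (tendsto_natCast_atTop_atTop.atTop_add tendsto_const_nhds).atTop_add tendsto_const_nhds
      refine h1.congr' (Eventually.of_forall fun n => ?_)
      show ((n : ℝ) + N + 1) = ‖(n : ℝ) + N + 1‖
      rw [Real.norm_eq_abs, abs_of_nonneg (by positivity)]
    exact (hd ω).lim v hc
  have hM₀ : M₀ ∈ U := mem_of_mem_nhds hU
  refine aestronglyMeasurable_of_tendsto_ae atTop (fun n => ?_) (ae_of_all _ hlim)
  show AEStronglyMeasurable (((n : ℝ) + N + 1) • (F (M₀ + ((n : ℝ) + N + 1)⁻¹ • v) - F M₀)) μ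
  exact ((hF _ (hmem n)).sub (hF _ hM₀)).const_smul ((n : ℝ) + N + 1)

/-! ## The abstract step: differentiating a locally uniformly dominated family under the integral -/

/-- ★ **The differentiation step.**  Let `U₀` be open, `F : H → Ω → E'` with `F(·, ω)` having derivative `F'(M, ω)` at
every `M ∈ U₀` for every `ω`, `F'(·, ω)` continuous on `U₀`, the derivative LOCALLY UNIFORMLY bounded in `ω`, and
`F(M, ·)` measurable and integrable for `M ∈ U₀` (finite measure).  Then at every `M₀ ∈ U₀`: `M ↦ ∫F(M)` has
derivative `∫F'(M₀)`; `M ↦ ∫F'(M)` is continuous at `M₀`; and `F'(M₀, ·)` is measurable and integrable (so the step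
iterates). [folklore] -/
theorem hasFDerivAt_integral_step {Ω : Type*} [MeasurableSpace Ω] {μ : Measure Ω} [IsFiniteMeasure μ]
    {H : Type*} [NormedAddCommGroup H] [NormedSpace ℝ H] [FiniteDimensional ℝ H]
    {E' : Type*} [NormedAddCommGroup E'] [NormedSpace ℝ E'] [CompleteSpace E']
    {U₀ : Set H} (hU₀ : IsOpen U₀) {F : H → Ω → E'} {F' : H → Ω → (H →L[ℝ] E')}
    (hmeas : ∀ M ∈ U₀, AEStronglyMeasurable (F M) μ) (hint : ∀ M ∈ U₀, Integrable (F M) μ)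
    (hder : ∀ ω, ∀ M ∈ U₀, HasFDerivAt (fun M => F M ω) (F' M ω) M)
    (hcont : ∀ ω, ContinuousOn (fun M => F' M ω) U₀)
    (hbd : ∀ M₀ ∈ U₀, ∃ ε > 0, ∃ C : ℝ, ball M₀ ε ⊆ U₀ ∧ ∀ ω, ∀ M ∈ ball M₀ ε, ‖F' M ω‖ ≤ C)
    {M₀ : H} (hM₀ : M₀ ∈ U₀) :
    HasFDerivAt (fun M => ∫ ω, F M ω ∂μ) (∫ ω, F' M₀ ω ∂μ) M₀ ∧
      ContinuousAt (fun M => ∫ ω, F' M ω ∂μ) M₀ ∧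
      AEStronglyMeasurable (F' M₀) μ ∧ Integrable (F' M₀) μ := by
  have hF'meas : ∀ M ∈ U₀, AEStronglyMeasurable (F' M) μ := fun M hM =>
    aestronglyMeasurable_fderiv_param' (hU₀.mem_nhds hM) hmeas fun ω => hder ω M hM
  obtain ⟨ε, hε, C, hball, hC⟩ := hbd M₀ hM₀
  have hbd' : ∀ᵐ ω ∂μ, ∀ M ∈ ball M₀ ε, ‖F' M ω‖ ≤ C := ae_of_all _ fun ω M hM => hC ω M hM
  have h1 : HasFDerivAt (fun M => ∫ ω, F M ω ∂μ) (∫ ω, F' M₀ ω ∂μ) M₀ :=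
    hasFDerivAt_integral_of_dominated_of_fderiv_le (ball_mem_nhds M₀ hε)
      (Filter.eventually_of_mem (ball_mem_nhds M₀ hε) fun M hM => hmeas M (hball hM)) (hint M₀ hM₀)
      (hF'meas M₀ hM₀) hbd' (integrable_const C) (ae_of_all _ fun ω M hM => hder ω M (hball hM))
  have h2 : ContinuousOn (fun M => ∫ ω, F' M ω ∂μ) (ball M₀ ε) :=
    continuousOn_of_dominated (fun M hM => hF'meas M (hball hM))
      (fun M hM => ae_of_all _ fun ω => hC ω M hM) (integrable_const C)
      (ae_of_all _ fun ω => (hcont ω).mono hball)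
  refine ⟨h1, h2.continuousAt (ball_mem_nhds M₀ hε), hF'meas M₀ hM₀, ?_⟩
  exact Integrable.of_bound (hF'meas M₀ hM₀) C (ae_of_all _ fun ω => hC ω M₀ (mem_ball_self hε))

/-- **`C¹` packaging of the step**: under the hypotheses of `hasFDerivAt_integral_step` (at every point of `U₀`),
`M ↦ ∫F(M)` is `C¹` on `U₀` with `D(∫F)(M) = ∫F'(M)` there. [folklore] -/
theorem contDiffOn_one_integral {Ω : Type*} [MeasurableSpace Ω] {μ : Measure Ω} [IsFiniteMeasure μ]
    {H : Type*} [NormedAddCommGroup H] [NormedSpace ℝ H] [FiniteDimensional ℝ H]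
    {E' : Type*} [NormedAddCommGroup E'] [NormedSpace ℝ E'] [CompleteSpace E']
    {U₀ : Set H} (hU₀ : IsOpen U₀) {F : H → Ω → E'} {F' : H → Ω → (H →L[ℝ] E')}
    (hmeas : ∀ M ∈ U₀, AEStronglyMeasurable (F M) μ) (hint : ∀ M ∈ U₀, Integrable (F M) μ)
    (hder : ∀ ω, ∀ M ∈ U₀, HasFDerivAt (fun M => F M ω) (F' M ω) M)
    (hcont : ∀ ω, ContinuousOn (fun M => F' M ω) U₀)
    (hbd : ∀ M₀ ∈ U₀, ∃ ε > 0, ∃ C : ℝ, ball M₀ ε ⊆ U₀ ∧ ∀ ω, ∀ M ∈ ball M₀ ε, ‖F' M ω‖ ≤ C) :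
    ContDiffOn ℝ 1 (fun M => ∫ ω, F M ω ∂μ) U₀ ∧
      ∀ M ∈ U₀, fderiv ℝ (fun M => ∫ ω, F M ω ∂μ) M = ∫ ω, F' M ω ∂μ := by
  have hstep := fun M (hM : M ∈ U₀) => hasFDerivAt_integral_step hU₀ hmeas hint hder hcont hbd hM
  have hfd : ∀ M ∈ U₀, fderiv ℝ (fun M => ∫ ω, F M ω ∂μ) M = ∫ ω, F' M ω ∂μ := fun M hM => (hstep M hM).1.fderiv
  refine ⟨?_, hfd⟩
  have hdiff : DifferentiableOn ℝ (fun M => ∫ ω, F M ω ∂μ) U₀ := fun M hM =>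
    (hstep M hM).1.differentiableAt.differentiableWithinAt
  have hcontfd : ContinuousOn (fderiv ℝ fun M => ∫ ω, F M ω ∂μ) U₀ := by
    intro M hM
    have hev : (fderiv ℝ fun M => ∫ ω, F M ω ∂μ) =ᶠ[𝓝 M] fun M => ∫ ω, F' M ω ∂μ :=
      Filter.eventuallyEq_of_mem (hU₀.mem_nhds hM) fun M' hM' => hfd M' hM'
    exact ((hstep M hM).2.1.congr_of_eventuallyEq hev).continuousWithinAt
  rw [show (1 : WithTop ℕ∞) = 0 + 1 from (zero_add 1).symm]
  exact (contDiffOn_succ_iff_fderiv_of_isOpen (𝕜 := ℝ) (n := 0) (f := fun M => ∫ ω, F M ω ∂μ) hU₀).2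
    ⟨hdiff, fun h0 => absurd h0 (by simp), contDiffOn_zero.2 hcontfd⟩

end Summit.QuantumFields.YangMills.Theorems.ColdStartUniversality

end
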